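import Literature.Barriers.AtomisticToContinuum.NoBVEstimatesMultiDCutoff
import Mathlib.Analysis.Normed.Lp.Matrix
import Mathlib.Topology.Algebra.Module.FiniteDimension
import Mathlib.Analysis.Calculus.ContDiff.WithLp
import HarnessLib

/-!
# Coefficient operator fields of the normalised symmetrizable system on `ℝᵏ = EuclideanSpace`

Brick B-γ, §1, of the Kato existence programme for the symmetrizable branch of Rauch's Local
Existence Theorem (towards `Rauch1986_smallAmplitudeExpansionL2`): Friedrichs' regularised scheme
and its energy estimates live in `L²(ℝᵈ; W)` with `W = EuclideanSpace ℝ (Fin k)` (the tree's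
`Literature.Analysis.PDE` layer: `foOp`, `opL2`, `mollL2`, `smoothRep`, `wordEnergy`), whereas a
`QuasilinearSystem d k` has matrix coefficients acting on `Fin k → ℝ`. This file is the
dictionary:

* `opCLM M` — a real `k × k` matrix as a bounded operator on `EuclideanSpace ℝ (Fin k)`
  (`Matrix.toLpLin 2 2`), `opCLMₗ` its linear dependence on `M`, and
  `contDiff_opCLM_of_entry` — **an entrywise smooth matrix field gives a smooth operator field**
  (`M = Σ Mᵢⱼ Eᵢⱼ`; no norm on matrices is needed);
* `exists_bound_iteratedFDeriv_of_eventually_const` — **a smooth map which is constant off a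
  ball has all its derivatives bounded** (compactness of the ball; off it the map is locally
  constant) — the source of the global coefficient bounds `‖DᵐÃⱼ‖, ‖DᵐB̃‖, ‖DᵐS̃‖ ≤ C_m` of the
  cut-off system [Majda1984, Ch. 2 §2.1].

Everything is proved; no named fact and no `sorry` is introduced.

## References

* [Majda1984] A. Majda, *Compressible Fluid Flow and Systems of Conservation Laws in Several
  Space Variables* (1984), Ch. 2, §2.1.
* [Friedrichs1954] K. O. Friedrichs, Comm. Pure Appl. Math. 7 (1954) 345–392, §1.
-/

noncomputable section

open Set Filter Matrix Metric WithLp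
open scoped ContDiff Topology

namespace Literature.Barriers.AtomisticToContinuum

variable {k : ℕ}

/-! ### Matrices as operators on `EuclideanSpace ℝ (Fin k)` -/

/-- A real `k × k` matrix as a bounded operator on `ℝᵏ = EuclideanSpace ℝ (Fin k)`.
[folklore] -/
def opCLM (M : Matrix (Fin k) (Fin k) ℝ) : EuclideanSpace ℝ (Fin k) →L[ℝ] EuclideanSpace ℝ (Fin k) :=
  LinearMap.toContinuousLinearMap (Matrix.toLpLin 2 2 M)

/-- `opCLM M y = M y`. [folklore] -/
@[simp] theorem opCLM_apply (M : Matrix (Fin k) (Fin k) ℝ) (y : EuclideanSpace ℝ (Fin k)) :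
    opCLM M y = toLp 2 (M *ᵥ ofLp y) := rfl

/-- `opCLM` is additive. [folklore] -/
theorem opCLM_add (M N : Matrix (Fin k) (Fin k) ℝ) : opCLM (M + N) = opCLM M + opCLM N := by
  ext y i
  simp [Matrix.add_mulVec]

/-- `opCLM` is homogeneous. [folklore] -/
theorem opCLM_smul (c : ℝ) (M : Matrix (Fin k) (Fin k) ℝ) : opCLM (c • M) = c • opCLM M := by
  ext y i
  simp [Matrix.smul_mulVec]

/-- `opCLM 1 = id`. [folklore] -/
@[simp] theorem opCLM_one : opCLM (1 : Matrix (Fin k) (Fin k) ℝ) = ContinuousLinearMap.id ℝ _ := by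
  ext y i
  simp

/-- `opCLM (M N) = opCLM M ∘ opCLM N`. [folklore] -/
theorem opCLM_mul (M N : Matrix (Fin k) (Fin k) ℝ) : opCLM (M * N) = (opCLM M).comp (opCLM N) := by
  ext y i
  simp [Matrix.mulVec_mulVec]

/-- `M ↦ opCLM M` as a linear map. [folklore] -/
def opCLMₗ : Matrix (Fin k) (Fin k) ℝ →ₗ[ℝ] (EuclideanSpace ℝ (Fin k) →L[ℝ] EuclideanSpace ℝ (Fin k)) where
  toFun := opCLM
  map_add' := opCLM_add
  map_smul' := opCLM_smul

/-- Unfolding of `opCLMₗ`. [folklore] -/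
@[simp] theorem opCLMₗ_apply (M : Matrix (Fin k) (Fin k) ℝ) : opCLMₗ M = opCLM M := rfl

/-- **Expansion in matrix units**: `opCLM M = Σᵢⱼ Mᵢⱼ • opCLM Eᵢⱼ`. [folklore] -/
theorem opCLM_eq_sum (M : Matrix (Fin k) (Fin k) ℝ) :
    opCLM M = ∑ i, ∑ j, M i j • opCLM (Matrix.single i j (1 : ℝ)) := by
  conv_lhs => rw [Matrix.matrix_eq_sum_single M]
  rw [← opCLMₗ_apply, map_sum]
  refine Finset.sum_congr rfl fun i _ => ?_
  rw [map_sum]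
  refine Finset.sum_congr rfl fun j _ => ?_
  have h : Matrix.single i j (M i j) = M i j • Matrix.single i j (1 : ℝ) := by
    rw [Matrix.smul_single, smul_eq_mul, mul_one]
  rw [h, map_smul, opCLMₗ_apply]

/-- **An entrywise smooth matrix field is a smooth operator field.** [folklore] -/
theorem contDiff_opCLM_of_entry {X : Type*} [NormedAddCommGroup X] [NormedSpace ℝ X] {n : WithTop ℕ∞}
    {M : X → Matrix (Fin k) (Fin k) ℝ} (hM : ∀ i j, ContDiff ℝ n fun x => M x i j) :
    ContDiff ℝ n fun x => opCLM (M x) := by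
  have hfun : (fun x => opCLM (M x)) =
      fun x => ∑ i, ∑ j, M x i j • opCLM (Matrix.single i j (1 : ℝ)) :=
    funext fun x => opCLM_eq_sum (M x)
  rw [hfun]
  exact ContDiff.sum fun i _ => ContDiff.sum fun j _ => (hM i j).smul contDiff_const

/-- The operator norm of `opCLM M` is controlled by the entries: `‖opCLM M‖ ≤ Σᵢⱼ |Mᵢⱼ|`
(each matrix unit has norm `≤ 1`). [folklore] -/
theorem norm_opCLM_le (M : Matrix (Fin k) (Fin k) ℝ) : ‖opCLM M‖ ≤ ∑ i, ∑ j, |M i j| := by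
  have hunit : ∀ i j : Fin k, ‖opCLM (Matrix.single i j (1 : ℝ))‖ ≤ 1 := by
    intro i j
    refine ContinuousLinearMap.opNorm_le_bound _ zero_le_one fun y => ?_
    rw [one_mul, opCLM_apply, EuclideanSpace.norm_eq, EuclideanSpace.norm_eq]
    refine Real.sqrt_le_sqrt (le_of_eq_of_le ?_ (Finset.single_le_sum (f := fun l => ‖(ofLp y) l‖ ^ 2)
      (fun _ _ => sq_nonneg _) (Finset.mem_univ j)))
    rw [Finset.sum_eq_single i]
    · simp [Matrix.mulVec, dotProduct, Matrix.single_apply]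
    · intro b _ hb
      simp [Matrix.mulVec, dotProduct, Ne.symm hb]
    · simp
  rw [opCLM_eq_sum]
  refine (norm_sum_le _ _).trans (Finset.sum_le_sum fun i _ => (norm_sum_le _ _).trans
    (Finset.sum_le_sum fun j _ => ?_))
  rw [norm_smul, Real.norm_eq_abs]
  exact (mul_le_mul_of_nonneg_left (hunit i j) (abs_nonneg _)).trans_eq (mul_one _)

/-! ### Smooth maps constant off a ball have bounded derivatives -/

/-- **A smooth map which is constant off a ball has all its derivatives bounded**: if `f` is
`C^∞` on a proper space and `f w = c₀` whenever `R ≤ dist w c`, then for every `m` there is `C`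
with `‖Dᵐf(w)‖ ≤ C` for all `w` (on the closed ball by compactness and continuity of `Dᵐf`;
off it `f` is locally constant, so `Dᵐf = 0` for `m ≥ 1`). [folklore] -/
theorem exists_bound_iteratedFDeriv_of_eventually_const {X V : Type*} [NormedAddCommGroup X]
    [NormedSpace ℝ X] [ProperSpace X] [NormedAddCommGroup V] [NormedSpace ℝ V] {f : X → V}
    (hf : ContDiff ℝ ∞ f) {c : X} {c₀ : V} {R : ℝ} (hR : ∀ w, R ≤ dist w c → f w = c₀) (m : ℕ) :
    ∃ C : ℝ, 0 ≤ C ∧ ∀ w, ‖iteratedFDeriv ℝ m f w‖ ≤ C := by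
  have hcont : Continuous (iteratedFDeriv ℝ m f) :=
    hf.continuous_iteratedFDeriv (by exact_mod_cast le_top)
  obtain ⟨C₁, hC₁⟩ := (isCompact_closedBall c R).bddAbove_image hcont.norm.continuousOn
  have hC₁' : ∀ w ∈ closedBall c R, ‖iteratedFDeriv ℝ m f w‖ ≤ C₁ := fun w hw => hC₁ ⟨w, hw, rfl⟩
  refine ⟨max C₁ ‖c₀‖, le_max_of_le_right (norm_nonneg _), fun w => ?_⟩
  by_cases hw : dist w c ≤ R
  · exact (hC₁' w hw).trans (le_max_left _ _)
  · -- off the closed ball `f` agrees with the constant `c₀` near `w`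
    have hlt : R < dist w c := not_le.1 hw
    have hev : f =ᶠ[𝓝 w] fun _ => c₀ := by
      have hopen : IsOpen {z : X | R < dist z c} := isOpen_lt continuous_const (continuous_id.dist continuous_const)
      filter_upwards [hopen.mem_nhds hlt] with z hz
      exact hR z (le_of_lt hz)
    have heq := (hev.iteratedFDeriv ℝ m).eq_of_nhds
    rw [heq]
    rcases Nat.eq_zero_or_pos m with hm | hm
    · subst hm
      rw [norm_iteratedFDeriv_zero]
      exact le_max_right _ _
    · rw [iteratedFDeriv_const_of_ne (Nat.pos_iff_ne_zero.1 hm)]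
      simp only [Pi.zero_apply, norm_zero]
      exact le_max_of_le_right (norm_nonneg _)

/-! ### The coefficient fields of the normalised system on `EuclideanSpace` -/

section Fields

open Literature.Analysis.FluidPDE QuasilinearSystem

variable {d : ℕ} (S : QuasilinearSystem d k) (Sym : (Fin k → ℝ) → Matrix (Fin k) (Fin k) ℝ)
  (ubar : Fin k → ℝ) {r : ℝ} (hr : 0 < r)
  (hSym : ∀ w ∈ closedBall ubar (2 * r), (Sym w * S.A0 w).PosDef ∧ ∀ j, (Sym w * S.A j w).IsSymm)

/-- **The operator fields `Ãⱼ(w) = (A₀⁻¹Aⱼ)(χ w)`** of the normalised system, on `EuclideanSpace`.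
[cite: Majda1984, Ch. 2 §2.1] -/
def Aop (j : Fin d) (w : EuclideanSpace ℝ (Fin k)) :
    EuclideanSpace ℝ (Fin k) →L[ℝ] EuclideanSpace ℝ (Fin k) :=
  opCLM ((normalize S ubar hr (det_ne_zero_of_sym ubar hSym)).A j (ofLp w))

/-- **The zeroth-order field `B̃(w) = (A₀⁻¹B)(χ w)`** of the normalised system, on `EuclideanSpace`.
[cite: Majda1984, Ch. 2 §2.1] -/
def Bvec (w : EuclideanSpace ℝ (Fin k)) : EuclideanSpace ℝ (Fin k) :=
  toLp 2 ((normalize S ubar hr (det_ne_zero_of_sym ubar hSym)).B (ofLp w))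

/-- **The symmetrizer field `S̃(w)`** of the normalised system, on `EuclideanSpace`.
[cite: Majda1984, Ch. 2 §2.1] -/
def Sop (w : EuclideanSpace ℝ (Fin k)) : EuclideanSpace ℝ (Fin k) →L[ℝ] EuclideanSpace ℝ (Fin k) :=
  opCLM (normSym S Sym ubar hr (ofLp w))

/-- `Ãⱼ` is smooth. [folklore] -/
theorem contDiff_Aop (j : Fin d) : ContDiff ℝ ∞ (Aop S Sym ubar hr hSym j) :=
  contDiff_opCLM_of_entry fun i i' =>
    ((normalize S ubar hr (det_ne_zero_of_sym ubar hSym)).contDiff_A j i i').comp PiLp.contDiff_ofLp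

/-- `B̃` is smooth. [folklore] -/
theorem contDiff_Bvec : ContDiff ℝ ∞ (Bvec S Sym ubar hr hSym) :=
  PiLp.contDiff_toLp.comp
    ((normalize S ubar hr (det_ne_zero_of_sym ubar hSym)).contDiff_B.comp PiLp.contDiff_ofLp)

/-- `S̃` is smooth. [folklore] -/
theorem contDiff_Sop (hSymd : ∀ i i', ContDiff ℝ ∞ fun u => Sym u i i') :
    ContDiff ℝ ∞ (Sop S Sym ubar hr) :=
  contDiff_opCLM_of_entry fun i i' =>
    (contDiff_normSym_apply ubar hr hSymd i i').comp PiLp.contDiff_ofLp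

/-- `Ãⱼ` is constant off the ball of radius `2r` about `ū`. [folklore] -/
theorem Aop_of_le_dist (j : Fin d) {w : EuclideanSpace ℝ (Fin k)} (hw : 2 * r ≤ dist (ofLp w) ubar) :
    Aop S Sym ubar hr hSym j w = opCLM ((S.A0 ubar)⁻¹ * S.A j ubar) := by
  rw [Aop, normalize_A_of_le_dist S ubar hr _ j hw]

/-- `B̃` is constant off the ball of radius `2r` about `ū`. [folklore] -/
theorem Bvec_of_le_dist {w : EuclideanSpace ℝ (Fin k)} (hw : 2 * r ≤ dist (ofLp w) ubar) :
    Bvec S Sym ubar hr hSym w = toLp 2 ((S.A0 ubar)⁻¹ *ᵥ S.B ubar) := by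
  rw [Bvec, normalize_B_of_le_dist S ubar hr _ hw]

/-- `S̃` is constant off the ball of radius `2r` about `ū`. [folklore] -/
theorem Sop_of_le_dist {w : EuclideanSpace ℝ (Fin k)} (hw : 2 * r ≤ dist (ofLp w) ubar) :
    Sop S Sym ubar hr w = opCLM (Sym ubar * S.A0 ubar) := by
  rw [Sop, normSym_of_le_dist ubar hr hw]

/-- `B̃(ū) = 0` when `B(ū) = 0`. [folklore] -/
theorem Bvec_ubar (hB : S.B ubar = 0) : Bvec S Sym ubar hr hSym (toLp 2 ubar) = 0 := by
  rw [Bvec, ofLp_toLp, normalize_B_ubar S ubar hr _ hB]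
  rfl

/-- **`S̃ Ãⱼ` is a symmetric operator** on `EuclideanSpace`: `⟪S̃Ãⱼ y, y'⟫ = ⟪y, S̃Ãⱼ y'⟫`.
[cite: Majda1984, Ch. 2 §2.1] -/
theorem inner_Sop_Aop_comm (j : Fin d) (w y y' : EuclideanSpace ℝ (Fin k)) :
    @inner ℝ _ _ ((Sop S Sym ubar hr w) (Aop S Sym ubar hr hSym j w y)) y' =
      @inner ℝ _ _ y ((Sop S Sym ubar hr w) (Aop S Sym ubar hr hSym j w y')) := by
  have hsymm := isSymm_normSym_mul_normalize_A ubar hr hSym j (ofLp w)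
  set P := normSym S Sym ubar hr (ofLp w) *
    (normalize S ubar hr (det_ne_zero_of_sym ubar hSym)).A j (ofLp w) with hP
  have h1 : (Sop S Sym ubar hr w) (Aop S Sym ubar hr hSym j w y) = toLp 2 (P *ᵥ ofLp y) := by
    simp [Sop, Aop, hP, Matrix.mulVec_mulVec]
  have h2 : (Sop S Sym ubar hr w) (Aop S Sym ubar hr hSym j w y') = toLp 2 (P *ᵥ ofLp y') := by
    simp [Sop, Aop, hP, Matrix.mulVec_mulVec]
  rw [h1, h2, EuclideanSpace.inner_eq_star_dotProduct, EuclideanSpace.inner_eq_star_dotProduct]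
  simp only [star_trivial]
  rw [Matrix.dotProduct_mulVec, ← Matrix.mulVec_transpose, hsymm.eq, dotProduct_comm]

include hSym in
/-- **`S̃` is a symmetric operator** on `EuclideanSpace`. [folklore] -/
theorem inner_Sop_comm (w y y' : EuclideanSpace ℝ (Fin k)) :
    @inner ℝ _ _ ((Sop S Sym ubar hr w) y) y' = @inner ℝ _ _ y ((Sop S Sym ubar hr w) y') := by
  have hsymm : (normSym S Sym ubar hr (ofLp w)).IsSymm := (posDef_normSym ubar hr hSym (ofLp w)).1
  rw [Sop, opCLM_apply, opCLM_apply, EuclideanSpace.inner_eq_star_dotProduct,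
    EuclideanSpace.inner_eq_star_dotProduct]
  simp only [star_trivial]
  rw [Matrix.dotProduct_mulVec, ← Matrix.mulVec_transpose, hsymm.eq, dotProduct_comm]

include hSym in
/-- **`S̃` is uniformly coercive**: `c‖y‖² ≤ ⟪S̃(w) y, y⟫` for all states `w` and all `y`
(from `exists_normSym_bounds`, comparing the Euclidean and the sup norm). [folklore] -/
theorem inner_Sop_self_ge (hSymd : ∀ i i', ContDiff ℝ ∞ fun u => Sym u i i') :
    ∃ c : ℝ, 0 < c ∧ ∀ w y : EuclideanSpace ℝ (Fin k),
      c * ‖y‖ ^ 2 ≤ @inner ℝ _ _ ((Sop S Sym ubar hr w) y) y := by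
  obtain ⟨c, C, hc, -, hcw⟩ := exists_normSym_bounds ubar hr hSymd hSym
  refine ⟨c / (k + 1), by positivity, fun w y => ?_⟩
  have h := (hcw (ofLp w)).1 (ofLp y)
  rw [Sop, opCLM_apply, EuclideanSpace.inner_eq_star_dotProduct]
  simp only [star_trivial]
  have hsq : ‖y‖ ^ 2 = ∑ i, ‖(ofLp y) i‖ ^ 2 := by
    rw [EuclideanSpace.norm_eq, Real.sq_sqrt (Finset.sum_nonneg fun _ _ => sq_nonneg _)]
  have hsum : ∑ i, ‖(ofLp y) i‖ ^ 2 ≤ (k + 1) * ‖ofLp y‖ ^ 2 := by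
    calc ∑ i, ‖(ofLp y) i‖ ^ 2 ≤ ∑ _i : Fin k, ‖ofLp y‖ ^ 2 :=
          Finset.sum_le_sum fun i _ => pow_le_pow_left₀ (norm_nonneg _) (norm_le_pi_norm _ i) 2
      _ = k * ‖ofLp y‖ ^ 2 := by simp
      _ ≤ (k + 1) * ‖ofLp y‖ ^ 2 := by nlinarith [sq_nonneg ‖ofLp y‖]
  have hk : (0 : ℝ) < k + 1 := by positivity
  calc c / (k + 1) * ‖y‖ ^ 2 = c / (k + 1) * ∑ i, ‖(ofLp y) i‖ ^ 2 := by rw [hsq]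
    _ ≤ c / (k + 1) * ((k + 1) * ‖ofLp y‖ ^ 2) :=
        mul_le_mul_of_nonneg_left hsum (div_nonneg hc.le hk.le)
    _ = c * ‖ofLp y‖ ^ 2 := by field_simp
    _ ≤ _ := h

include hSym in
/-- **`S̃` is uniformly bounded**: `‖S̃(w)‖ ≤ C` for all states. [folklore] -/
theorem norm_Sop_le (hSymd : ∀ i i', ContDiff ℝ ∞ fun u => Sym u i i') :
    ∃ C : ℝ, 0 ≤ C ∧ ∀ w : EuclideanSpace ℝ (Fin k), ‖Sop S Sym ubar hr w‖ ≤ C := by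
  obtain ⟨c, C, -, hC, hcw⟩ := exists_normSym_bounds ubar hr hSymd hSym
  refine ⟨∑ _i : Fin k, ∑ _j : Fin k, C, Finset.sum_nonneg fun _ _ => Finset.sum_nonneg fun _ _ => hC,
    fun w => (norm_opCLM_le _).trans (Finset.sum_le_sum fun i _ => Finset.sum_le_sum fun j _ => ?_)⟩
  exact (hcw (ofLp w)).2 i j

end Fields

end Literature.Barriers.AtomisticToContinuum

end
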